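import Literature.NumberTheory.DiophantineGeometry.BertiniResultantProofs
import Literature.NumberTheory.DiophantineGeometry.PlaneCurveSeparableFibersProofs
import HarnessLib

/-!
# No small polynomial of low degree vanishes on a truncated root: the two-weight resultant bound

Refinement of `BertiniResultantProofs.eq_zero_of_pow_dvd_eval` (Kaltofen's injectivity step in
Cafure–Matera's Thm. 3.3) in which the annihilator `h ∈ A[Y][X]` is allowed its own, smaller,
bounds: `deg_X h ≤ D` and `X`-coefficients of `Y`-degree `≤ d'`, against `deg_X χ = δ` and
`X`-coefficients of `χ` of `Y`-degree `≤ d`. Then `Res_X^{δ,D}(χ, h)` has `Y`-degree `≤ D d + δ d'`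
(`natDegree_resultant_le_two_weights`: in the Sylvester matrix the `D` columns built from `χ`
have entries of degree `≤ d` and the `δ` columns built from `h` have entries of degree `≤ d'`),
so the precision needed is only `κ > D d + δ d'` (`eq_zero_of_pow_dvd_eval_two_weights`) — for
factors of total degree `≤ D` of a plane section of degree `δ` this is Cafure–Matera's order of
approximation `2D` (there `d = δ`, `d' = D`, `κ > 2Dδ`) instead of Kaltofen's `(2δ-1)δ`.

No definitions, no new named facts.

## References

* A. Cafure, G. Matera, Finite Fields Appl. 12 (2006) 155–185, §3.1 (order of approximation
  `τ = 2D`) and proof of Thm. 3.3. [CafureMatera2006]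
* E. Kaltofen, J. Comput. System Sci. 50 (1995) 274–295, §3. [Kaltofen1995]
-/

noncomputable section

open scoped Classical Polynomial
open Polynomial

namespace Literature.NumberTheory.DiophantineGeometry

universe u

variable {A : Type u} [CommRing A]

/-- **Two-weight degree bound for the resultant:** if the `X`-coefficients of `F ∈ A[Y][X]` have
`Y`-degree `≤ d` and those of `G` have `Y`-degree `≤ d'`, then
`deg_Y Res_X^{m,n}(F, G) ≤ n d + m d'` (the Sylvester matrix has `n` columns of coefficients of
`F` and `m` columns of coefficients of `G`). [folklore] -/
theorem natDegree_resultant_le_two_weights (F G : A[X][X]) (m n d d' : ℕ)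
    (hF : ∀ i, (F.coeff i).natDegree ≤ d) (hG : ∀ i, (G.coeff i).natDegree ≤ d') :
    (resultant F G m n).natDegree ≤ n * d + m * d' := by
  rw [resultant]
  refine natDegree_det_le_of_forall_perm _ _ fun σ _ ↦ ?_
  -- column weights: `d'` on the `m` columns of `G`, `d` on the `n` columns of `F`
  let b : Fin (m + n) → ℕ := fun j ↦ j.addCases (fun _ ↦ d') (fun _ ↦ d)
  have hentry : ∀ i j, (sylvester F G m n i j).natDegree ≤ b j := by
    intro i j
    induction j using Fin.addCases with
    | left j₁ =>
      simp only [sylvester, Matrix.of_apply, Fin.addCases_left, b]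
      split_ifs <;> simp [hG]
    | right j₁ =>
      simp only [sylvester, Matrix.of_apply, Fin.addCases_right, b]
      split_ifs <;> simp [hF]
  calc ∑ j, (sylvester F G m n (σ j) j).natDegree ≤ ∑ j, b j :=
        Finset.sum_le_sum fun j _ ↦ hentry (σ j) j
    _ = n * d + m * d' := by
        rw [Fin.sum_univ_add]
        simp only [b, Fin.addCases_left, Fin.addCases_right, Finset.sum_const, Finset.card_univ,
          Fintype.card_fin, smul_eq_mul]
        ring

/-- **No nonzero `h` of `X`-degree `≤ D < δ` and coefficients of `Y`-degree `≤ d'` vanishes to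
precision `Y^κ`, `κ > D d + δ d'`, on a truncated root of an irreducible `χ`** (`deg_X χ = δ`,
unit leading coefficient, `X`-coefficients of `Y`-degree `≤ d`; `A` a factorial domain). This is
`eq_zero_of_pow_dvd_eval` with the two-weight resultant bound; for `d = δ`, `d' = D` it is the
injectivity of Cafure–Matera's linear system (8) at order of approximation `2D`.
[cite: CafureMatera2006, Lemma 3.1 and proof of Thm. 3.3] [cite: Kaltofen1995, §3] -/
theorem eq_zero_of_pow_dvd_eval_two_weights [IsDomain A] [UniqueFactorizationMonoid A]
    {χ h : A[X][X]} {δ D d d' κ : ℕ} (hδ : 1 ≤ δ) (hχdeg : χ.natDegree = δ)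
    (hχu : IsUnit χ.leadingCoeff) (hχirr : Irreducible χ)
    (hχc : ∀ i, (χ.coeff i).natDegree ≤ d) (hD : D + 1 ≤ δ) (hhdeg : h.natDegree ≤ D)
    (hhc : ∀ i, (h.coeff i).natDegree ≤ d') (hκ : D * d + δ * d' < κ)
    {a : A[X]} (hχa : (X : A[X]) ^ κ ∣ χ.eval a) (hha : (X : A[X]) ^ κ ∣ h.eval a) : h = 0 := by
  by_contra hh0
  -- the resultant is a combination `p χ + q h`
  obtain ⟨p, q, -, -, hpq⟩ := exists_mul_add_mul_eq_C_resultant χ h (m := δ) (n := D)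
    hχdeg.le hhdeg (Or.inl (by omega))
  set Res := resultant χ h δ D with hRes
  -- `Y^κ ∣ Res` by evaluation at `X = a`
  have hdvd : (X : A[X]) ^ κ ∣ Res := by
    have h1 := congrArg (Polynomial.eval a) hpq
    rw [eval_add, eval_mul, eval_mul, eval_C] at h1
    rw [← h1]
    exact dvd_add (hχa.mul_right _) (hha.mul_right _)
  -- the degree bound forces `Res = 0`
  have hRes0 : Res = 0 := by
    refine Polynomial.eq_zero_of_dvd_of_natDegree_lt hdvd ?_
    rw [natDegree_X_pow]
    exact (natDegree_resultant_le_two_weights χ h δ D d d' hχc hhc).trans_lt hκ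
  -- pass to the fraction field of `A[Y]`
  set K := FractionRing A[X] with hK
  have hinj : Function.Injective (algebraMap A[X] K) := IsFractionRing.injective _ _
  have hmap := resultant_map_map χ h δ D (algebraMap A[X] K)
  rw [← hRes, hRes0, map_zero] at hmap
  set χK := χ.map (algebraMap A[X] K) with hχK
  set hK' := h.map (algebraMap A[X] K) with hhK'
  have hK0 : hK' ≠ 0 := (Polynomial.map_ne_zero_iff hinj).2 hh0
  have hχKdeg : χK.natDegree = δ := by rw [hχK, natDegree_map_eq_of_injective hinj, hχdeg]
  have hhKdeg : hK'.natDegree ≤ D := by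
    rw [hhK', natDegree_map_eq_of_injective hinj]; exact hhdeg
  -- remove the degree padding
  obtain ⟨k, hk⟩ : ∃ k, D = hK'.natDegree + k := ⟨D - hK'.natDegree, by omega⟩
  rw [hk, resultant_add_right_deg _ _ _ _ k le_rfl] at hmap
  have hχK0 : χK ≠ 0 := fun h0 ↦ by rw [h0, natDegree_zero] at hχKdeg; omega
  have hlc : χK.coeff δ ≠ 0 := by
    rw [← hχKdeg, coeff_natDegree]
    exact leadingCoeff_ne_zero.2 hχK0
  have hres0 : resultant χK hK' δ hK'.natDegree = 0 :=
    (mul_eq_zero.1 hmap).resolve_left (pow_ne_zero _ hlc)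
  rw [← hχKdeg] at hres0
  have hncop : ¬ IsCoprime χK hK' := (resultant_eq_zero_iff.1 hres0).2
  have hirrK : Irreducible χK := irreducible_map_fractionRing_of_isUnit_leadingCoeff hχirr hχu
  have hdvdK : χK ∣ hK' := by
    by_contra hnd
    exact hncop (hirrK.coprime_iff_not_dvd.2 hnd)
  have := natDegree_le_of_dvd hdvdK hK0
  omega

end Literature.NumberTheory.DiophantineGeometry
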